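import Summits.ResolutionOfSingularities.ResolutionOfSingularities.Theorems.MarkedTransferCampaignW24ReducedBridgePStep
import Summits.ResolutionOfSingularities.ResolutionOfSingularities.Theorems.MarkedTransferCampaignW24SomeDepthRefutation
import HarnessLib

/-!
# The LEVEL-`q` bridge at an ARBITRARY PRIME `p`, part 5: a REDUCED ESCAPE at every large `p`-power depth REFUTES the OURS premise
# for the twin carrier `Φ_{q,r₀} G₀` (HIRONAKA-L · cell `res-hironaka` · slot W2.4 «bottom-member re-run»; the converse companion of
# `…ReducedBridgePRun.lean`; generalises res-D-pv-020's `p = 2, e = 1` `not_staysInBox_of_escape` of `…ReducedBridgeRun.lean`)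

**HONEST FRAMING.** OURS throughout: kernel theorems connecting OURS objects of the cell (res-L1-k24's `CampaignW24.ReducedRun`, res-type-059's
`CampaignW24.StaysInBox/IsBottomRun/stepAt`, `exhausts_of_staysInBox`, res-D-pv-020's `CampaignW24.ReducedBridge(P)`). Nothing below is a
statement of H. Hironaka's manuscript [Hironaka2017] (lit key `paper:url-3343fd9e678b`), nothing asserts that any statement of it holds, nothing is
a claim about resolution of singularities in characteristic `p`; the manuscript stays «under review» (D-0012/D-0089). AI work, weaker than expert
review. Written by res-D-pv-020 (W2.4 lineage). NO escaping polynomial at any odd `p` is exhibited here — this file says what a kit/kernel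
escape witness (res-type-059's census, res-L1-type-o6) would have to deliver to refute ⟨`Rescue.FiniteSupportStaysInBox_ours p`⟩ on `n = 1`.

## What is proved (`K` of characteristic `p`, `p` prime; `0 < e ≤ ℓ`; `q = p^e`; `F₀ = Φ_{q,r₀} G₀ + R₀`, passenger residues `good ⊆ PairLTP p · r₀`)
* `run_of_level_of_escapeP`: under a reduced ESCAPE at depth `p^{ℓ−e}` (states `i < i₁` non-zero of order `≥ 2`, state `i₁` non-zero of
  order `≥ p^{ℓ−e}`) every legal depth-`ℓ` run from `F₀` has length `≤ i₁` and is `Φ_{q,r₀}(canonRun …) + passenger`.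
* `not_isLowerClass_of_levelP`: a state whose top residue class is alive is not of lower class; `not_staysInBox_of_escapeP`.
* **`not_carrierStaysInBox_of_escapesP`**: `G₀ ≠ 0`, `G₀(0) = 0`, `r₀ < q`, `p ∤ r₀`, reduced escapes at EVERY `p`-power depth `p^a`, `a ≥ a₀`
  ⇒ `¬ Rescue.CarrierStaysInBox p e (Φ_{q,r₀} G₀)`; **`not_finiteSupportStaysInBox_ours_of_escapesP`**: if moreover `Φ_{q,r₀} G₀ = ↑P` for a
  polynomial `P`, then `¬ ⟨Rescue.FiniteSupportStaysInBox_ours p⟩`. With `…PRun`: on `n = 1` the OURS premise sits BETWEEN «every reduced run is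
  exhausted in box at all large p-power depths» (sufficient) and «no reduced run escapes at all large p-power depths» (necessary).
Hypotheses: each theorem's own binders; no FACT-LIST fact, no DEFECT binder. Standard axioms only.
-/

noncomputable section

set_option linter.dupNamespace false -- mandated namespace of this single-conjunct summit

namespace Summit.ResolutionOfSingularities.ResolutionOfSingularities.Theorems

namespace CampaignW24

namespace ReducedBridgeP

open Literature.AlgebraicGeometry.Hironaka2017.S08UnitMonomial (StandardExpression nonempty_standardExpression_topFrame)
open Literature.AlgebraicGeometry.Hironaka2017.S09LLUED
open Literature.AlgebraicGeometry.Hironaka2017.S09LLUED.TopFrontier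
open Literature.AlgebraicGeometry.Hironaka2017.S09LLUED.TopDeriv
open Literature.AlgebraicGeometry.Hironaka2017.S09LLUED.FrontierDrop (expo)
open Literature.AlgebraicGeometry.Resolution (adicOrder)
open Literature.RingTheory.MvPowerSeries (adicOrder_eq_order)
open CampaignW21 (xs hasseD)
open ReducedBridge

variable {K : Type} [Field K] {p : ℕ} [hp : Fact p.Prime] [CharP K p]

/-! ## §1 Runs under a reduced escape -/

/-- **Run bridge under a reduced ESCAPE at depth `p^{ℓ−e}`**: every legal depth-`ℓ` run from `F₀ = Φ_{q,r₀} G₀ + R₀` has length `≤ i₁` and is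
`Φ_{q,r₀}(canonRun p^{ℓ−e} G₀ i) + R_i` with passengers `R_i` (residues in `good`). [folklore] -/
theorem run_of_level_of_escapeP {e ℓ : ℕ} (he : 0 < e) (hle : e ≤ ℓ) {r₀ : ℕ} (hr₀ : r₀ < p ^ e) {good : ℕ → Prop}
    (hgood : ∀ ρ, good ρ → PairLTP p ρ r₀) {G₀ : PowerSeries K} {R₀ : MvPowerSeries (Fin 1) K} (hR₀ : ResIn (p ^ e) good R₀)
    {N : ℕ} {εs : ℕ → MvPowerSeries (Fin 1) K} (h0 : εs 0 = phiQ (p ^ e) (ppow_ne_zero p e) r₀ G₀ + R₀)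
    (hrun : IsBottomRun p e ℓ εs N) {i₁ : ℕ}
    (hpre : ∀ i < i₁, ReducedRun.canonRun (p ^ (ℓ - e)) G₀ i ≠ 0 ∧
      (2 : ℕ∞) ≤ PowerSeries.order (ReducedRun.canonRun (p ^ (ℓ - e)) G₀ i))
    (hesc : ReducedRun.canonRun (p ^ (ℓ - e)) G₀ i₁ ≠ 0 ∧
      ((p ^ (ℓ - e) : ℕ) : ℕ∞) ≤ PowerSeries.order (ReducedRun.canonRun (p ^ (ℓ - e)) G₀ i₁)) :
    ∀ i ≤ N, i ≤ i₁ ∧ ∃ Ri : MvPowerSeries (Fin 1) K, ResIn (p ^ e) good Ri ∧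
      εs i = phiQ (p ^ e) (ppow_ne_zero p e) r₀ (ReducedRun.canonRun (p ^ (ℓ - e)) G₀ i) + Ri := by
  intro i
  induction i with
  | zero => exact fun _ => ⟨Nat.zero_le _, R₀, hR₀, h0⟩
  | succ i ih =>
    intro hi
    obtain ⟨hii₁, Ri, hRi, hεi⟩ := ih (Nat.le_of_succ_le hi)
    obtain ⟨X, w, c, hX0, hsole, hbox, hw, hstep⟩ := hrun i hi
    have hfin_of : ∀ G : PowerSeries K, G ≠ 0 → PowerSeries.order G = ((PowerSeries.order G).toNat : ℕ∞) :=
      fun G hG => (ENat.coe_toNat fun h => hG (PowerSeries.order_eq_top.mp h)).symm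
    rcases Nat.lt_or_ge i i₁ with hlt | hge
    · obtain ⟨hne, h2⟩ := hpre i hlt
      have hfin := hfin_of _ hne
      have h2k : 2 ≤ (PowerSeries.order (ReducedRun.canonRun (p ^ (ℓ - e)) G₀ i)).toNat := by
        rw [hfin] at h2
        exact_mod_cast h2
      obtain ⟨R', hR', hE'⟩ := stepAt_of_level_caseIP X hεi hr₀ hRi hgood he hle hX0 hfin h2k hsole hw c
      exact ⟨hlt, R', hR', by rw [hstep, hE']; rfl⟩
    · exfalso
      have heq : i = i₁ := le_antisymm hii₁ hge
      subst heq
      obtain ⟨hne, hP⟩ := hesc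
      have hfin := hfin_of _ hne
      have hlt := (depthBox_iff_of_levelP X hεi hr₀ hRi hgood he hle hX0 hfin).mp hbox
      rw [hfin] at hP
      have hP' := ENat.coe_le_coe.mp hP
      omega

/-- **A state whose top residue class is alive is NOT of lower class** relative to a reference datum of `F₀ = Φ_{q,r₀} G₀ + R₀` (`G₀ ≠ 0`): a
top-residue monomial can only be carried by a summand with the digits of `r₀`, i.e. with the top pair itself. [folklore] -/
theorem not_isLowerClass_of_levelP {e ℓ₀ : ℕ} {F₀ R₀ F R : MvPowerSeries (Fin 1) K} {G₀ G : PowerSeries K} {r₀ : ℕ}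
    {good good' : ℕ → Prop} (X₀ : StandardExpression p (xs K 1) e ℓ₀ F₀) (hF₀ : F₀ = phiQ (p ^ e) (ppow_ne_zero p e) r₀ G₀ + R₀)
    (hr₀ : r₀ < p ^ e) (hR₀ : ResIn (p ^ e) good R₀) (hgood : ∀ ρ, good ρ → PairLTP p ρ r₀) (he : 0 < e) (hle₀ : e ≤ ℓ₀)
    (hG₀ : G₀ ≠ 0) (hF : F = phiQ (p ^ e) (ppow_ne_zero p e) r₀ G + R) (hR : ResIn (p ^ e) good' R)
    (hgood' : ∀ ρ, good' ρ → PairLTP p ρ r₀) (hG : G ≠ 0) : ¬ IsLowerClass X₀ F := by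
  intro hlow
  obtain ⟨hα, hβ⟩ := alpha_beta_of_levelP X₀ hF₀ hr₀ hR₀ hgood he hle₀ hG₀
  obtain ⟨k, hk⟩ : ∃ k, PowerSeries.coeff k G ≠ 0 := by
    by_contra h
    push Not at h
    exact hG (PowerSeries.ext fun k => by rw [h k, map_zero])
  have hm : MvPowerSeries.coeff (Finsupp.single 0 (r₀ + p ^ e * k)) F ≠ 0 := by rwa [coeff_top_residueP hF hr₀ hR hgood']
  obtain ⟨t, ht, -, hlt, hmod⟩ := hlow _ hm
  have hres : (r₀ + p ^ e * k) % p ^ e = expo p e t 0 % p ^ e := by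
    have h := hmod 0
    rwa [Finsupp.single_eq_same] at h
  rw [Nat.add_mul_mod_self_left, Nat.mod_eq_of_lt hr₀, expo_modP X₀ he ht] at hres
  obtain ⟨h1, h2⟩ : r₀ % p = t.1 0 ∧ r₀ / p = t.2.1 0 := hres ▸ digit_mod_div hp.out.pos (X₀.a_lt _ ht 0)
  apply lt_irrefl (pairKey t)
  have hkey : pairKey t = toLex (toLex (alpha X₀.support X₀.u), toLex (beta X₀.support X₀.u)) := by
    rw [pairKey, hα, hβ, eq_single t.1, eq_single t.2.1, ← h1, ← h2]
  exact hkey ▸ hlt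

/-- **A reduced escape at depth `p^{ℓ−e}` refutes box-confinement at depth `ℓ`** (`K` perfect; reference datum `X₀` of `F₀` with non-empty top
block, `α ≠ 0`, `q < ord F₀`): by `exhausts_of_staysInBox` a confined depth carries a legal run INTO lower class; under the escape every legal
run keeps the top residue class alive. [folklore] -/
theorem not_staysInBox_of_escapeP [ExpChar K p] [PerfectRing K p] {e ℓ₀ ℓ : ℕ} (he : 0 < e) (hle₀ : e ≤ ℓ₀) (hℓ : ℓ₀ ≤ ℓ) {r₀ : ℕ}
    (hr₀ : r₀ < p ^ e) {good : ℕ → Prop} (hgood : ∀ ρ, good ρ → PairLTP p ρ r₀) {G₀ : PowerSeries K} (hG₀ : G₀ ≠ 0)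
    {F₀ R₀ : MvPowerSeries (Fin 1) K} (X₀ : StandardExpression p (xs K 1) e ℓ₀ F₀)
    (hF₀ : F₀ = phiQ (p ^ e) (ppow_ne_zero p e) r₀ G₀ + R₀) (hR₀ : ResIn (p ^ e) good R₀)
    (h00 : 0 < frontierLength X₀.support X₀.u) (hα : alpha X₀.support X₀.u ≠ 0) (hord : ((p ^ e : ℕ) : ℕ∞) < adicOrder F₀)
    {i₁ : ℕ}
    (hpre : ∀ i < i₁, ReducedRun.canonRun (p ^ (ℓ - e)) G₀ i ≠ 0 ∧
      (2 : ℕ∞) ≤ PowerSeries.order (ReducedRun.canonRun (p ^ (ℓ - e)) G₀ i))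
    (hesc : ReducedRun.canonRun (p ^ (ℓ - e)) G₀ i₁ ≠ 0 ∧
      ((p ^ (ℓ - e) : ℕ) : ℕ∞) ≤ PowerSeries.order (ReducedRun.canonRun (p ^ (ℓ - e)) G₀ i₁)) :
    ¬ StaysInBox p e ℓ X₀ := by
  intro hstay
  haveI : PerfectField K := PerfectRing.toPerfectField K p
  obtain ⟨N, εs, h0, hrun, hlow⟩ := exhausts_of_staysInBox X₀ he hle₀ h00 hα hord hℓ hstay
  have h0' : εs 0 = phiQ (p ^ e) (ppow_ne_zero p e) r₀ G₀ + R₀ := by rw [h0, hF₀]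
  obtain ⟨hN, RN, hRN, hεN⟩ := run_of_level_of_escapeP he (le_trans hle₀ hℓ) hr₀ hgood hR₀ h0' hrun hpre hesc N le_rfl
  have hGN : ReducedRun.canonRun (p ^ (ℓ - e)) G₀ N ≠ 0 := by
    rcases Nat.lt_or_ge N i₁ with h | h
    · exact (hpre N h).1
    · rw [le_antisymm hN h]; exact hesc.1
  exact not_isLowerClass_of_levelP X₀ hF₀ hr₀ hR₀ hgood he hle₀ hG₀ hεN hRN hgood hGN hlow

/-! ## §2 Escapes at every large `p`-power depth refute the OURS premise for the twin carrier -/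

omit [CharP K p] in
/-- `ord Φ_{q,r₀} G₀ > q` when `G₀(0) = 0` and `0 < r₀ < q`. [folklore] -/
theorem lt_order_phiQ {e r₀ : ℕ} (hr₀ : r₀ < p ^ e) (hr₀pos : 0 < r₀) {G₀ : PowerSeries K} (hG₀0 : PowerSeries.constantCoeff G₀ = 0) :
    ((p ^ e : ℕ) : ℕ∞) < (phiQ (p ^ e) (ppow_ne_zero p e) r₀ G₀).order := by
  have hq : 0 < p ^ e := pow_pos hp.out.pos e
  have h : ((p ^ e + 1 : ℕ) : ℕ∞) ≤ (phiQ (p ^ e) (ppow_ne_zero p e) r₀ G₀).order := by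
    refine MvPowerSeries.nat_le_order fun d hd => ?_
    rw [coeff_phiQ_of_lt _ hr₀]
    split_ifs with h
    · have hdeg : d.degree = d 0 := by rw [eq_single d, Finsupp.degree_single, Finsupp.single_eq_same]
      rw [hdeg] at hd
      have hd' : d 0 < p ^ e + 1 := by exact_mod_cast hd
      have hlt : d 0 < p ^ e := by
        rcases Nat.lt_or_ge (d 0) (p ^ e) with h' | h'
        · exact h'
        · exfalso
          have : d 0 = p ^ e := by omega
          rw [this, Nat.mod_self] at h
          omega
      rw [Nat.div_eq_of_lt hlt, PowerSeries.coeff_zero_eq_constantCoeff_apply, hG₀0]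
    · rfl
  exact lt_of_lt_of_le (by exact_mod_cast Nat.lt_succ_self _) h

/-- **Reduced escapes at every large `p`-power depth refute `Rescue.CarrierStaysInBox p e (Φ_{q,r₀} G₀)`** (`K` of characteristic `p` with the
premise binders; `0 < e`; `0 < r₀ < q = p^e`, `p ∤ r₀`; `G₀ ≠ 0`, `G₀(0) = 0`): take the reference datum of depth `e + a₀` that every series
has over a perfect field (`nonempty_standardExpression_topFrame`); its top pair is the digit pair of `r₀` (`α ≠ 0` as `p ∤ r₀`), `ord > q`; at
every depth `ℓ ≥ e + a₀` the escape at `p^{ℓ−e}` refutes `StaysInBox`. OURS objects; nothing about the manuscript. [folklore] -/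
theorem not_carrierStaysInBox_of_escapesP [ExpChar K p] [PerfectRing K p] {e : ℕ} (he : 0 < e) {r₀ : ℕ} (hr₀ : r₀ < p ^ e)
    (hr₀p : r₀ % p ≠ 0) {G₀ : PowerSeries K} (hG₀ : G₀ ≠ 0) (hG₀0 : PowerSeries.constantCoeff G₀ = 0) {a₀ : ℕ}
    (hesc : ∀ a, a₀ ≤ a → ∃ i₁ : ℕ,
      (∀ i < i₁, ReducedRun.canonRun (p ^ a) G₀ i ≠ 0 ∧ (2 : ℕ∞) ≤ PowerSeries.order (ReducedRun.canonRun (p ^ a) G₀ i)) ∧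
      ReducedRun.canonRun (p ^ a) G₀ i₁ ≠ 0 ∧ ((p ^ a : ℕ) : ℕ∞) ≤ PowerSeries.order (ReducedRun.canonRun (p ^ a) G₀ i₁)) :
    ¬ Rescue.CarrierStaysInBox p e (phiQ (p ^ e) (ppow_ne_zero p e) r₀ G₀) := by
  intro h
  haveI : PerfectField K := PerfectRing.toPerfectField K p
  have hr₀pos : 0 < r₀ := Nat.pos_of_ne_zero fun h0 => hr₀p (by rw [h0, Nat.zero_mod])
  have hF₀ : phiQ (p ^ e) (ppow_ne_zero p e) r₀ G₀ = phiQ (p ^ e) (ppow_ne_zero p e) r₀ G₀ + 0 := (add_zero _).symm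
  obtain ⟨X₀⟩ := nonempty_standardExpression_topFrame (p := p) K 1 e (e + a₀) (phiQ (p ^ e) (ppow_ne_zero p e) r₀ G₀)
  have hne : phiQ (p ^ e) (ppow_ne_zero p e) r₀ G₀ ≠ 0 := fun h0 => hG₀ ((phiQ_eq_zero_iff _ hr₀ G₀).mp h0)
  have h00 : 0 < frontierLength X₀.support X₀.u := frontierLength_pos_of_ne_zero X₀ hne
  have hRin : ResIn (p ^ e) (fun ρ => PairLTP p ρ r₀) (0 : MvPowerSeries (Fin 1) K) := resIn_zero _
  obtain ⟨hα, -⟩ := alpha_beta_of_levelP X₀ hF₀ hr₀ hRin (fun _ h => h) he (by omega) hG₀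
  have hαne : alpha X₀.support X₀.u ≠ 0 := by rw [hα]; exact Finsupp.single_ne_zero.mpr hr₀p
  have hord : ((p ^ e : ℕ) : ℕ∞) < adicOrder (phiQ (p ^ e) (ppow_ne_zero p e) r₀ G₀) := by
    rw [adicOrder_eq_order]; exact lt_order_phiQ hr₀ hr₀pos hG₀0
  obtain ⟨ℓ, hℓ, hstay⟩ := h (e + a₀) X₀ he (by omega) h00 hαne hord
  obtain ⟨i₁, hpre, hne₁, hP⟩ := hesc (ℓ - e) (by omega)
  exact not_staysInBox_of_escapeP he (by omega) hℓ hr₀ (fun _ h => h) hG₀ X₀ hF₀ hRin h00 hαne hord hpre ⟨hne₁, hP⟩ hstay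

/-- **… hence refute ⟨`Rescue.FiniteSupportStaysInBox_ours p`⟩ when the twin carrier is a polynomial** (`Φ_{q,r₀} G₀ = ↑P`). No such escaping
polynomial is exhibited here (at `p = 2` none exists: res-L1-type-o6's death theorem; at odd `p` the question is OPEN — res-type-059's census).
OURS objects; nothing about the manuscript. [folklore] -/
theorem not_finiteSupportStaysInBox_ours_of_escapesP [ExpChar K p] [PerfectRing K p] {e : ℕ} (he : 0 < e) {r₀ : ℕ}
    (hr₀ : r₀ < p ^ e) (hr₀p : r₀ % p ≠ 0) {G₀ : PowerSeries K} (hG₀ : G₀ ≠ 0) (hG₀0 : PowerSeries.constantCoeff G₀ = 0)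
    (P : MvPolynomial (Fin 1) K) (hP : (P : MvPowerSeries (Fin 1) K) = phiQ (p ^ e) (ppow_ne_zero p e) r₀ G₀) {a₀ : ℕ}
    (hesc : ∀ a, a₀ ≤ a → ∃ i₁ : ℕ,
      (∀ i < i₁, ReducedRun.canonRun (p ^ a) G₀ i ≠ 0 ∧ (2 : ℕ∞) ≤ PowerSeries.order (ReducedRun.canonRun (p ^ a) G₀ i)) ∧
      ReducedRun.canonRun (p ^ a) G₀ i₁ ≠ 0 ∧ ((p ^ a : ℕ) : ℕ∞) ≤ PowerSeries.order (ReducedRun.canonRun (p ^ a) G₀ i₁)) :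
    ¬ Rescue.FiniteSupportStaysInBox_ours p := fun h =>
  not_carrierStaysInBox_of_escapesP he hr₀ hr₀p hG₀ hG₀0 hesc (hP ▸ h K 1 e P)

end ReducedBridgeP

end CampaignW24

end Summit.ResolutionOfSingularities.ResolutionOfSingularities.Theorems

end
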